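import Literature.NumberTheory.LFunctions.Zhang2022.Section12U024Mellin
import Literature.NumberTheory.LFunctions.Zhang2022.GaussKernelContour
import Literature.NumberTheory.LFunctions.Zhang2022.Section12Ded1217Sizes
import HarnessLib

/-!
# Zhang (2022) §12 p. 69, step u025: the Perron integral `lineInt024` as a difference of two
# Gaussian-kernel vertical-line integrals of the Lemma-8.3 quotient `Φ`

Topic `Literature/NumberTheory/LFunctions/Zhang2022` (Landau–Siegel audit tree; verdict-neutral).
Y. Zhang, *Discrete mean estimates and the Landau–Siegel zero*, arXiv:2211.02515v1 (2022)
[Zhang2022LandauSiegel], §12 proof of Lemma 12.2, p. 69, tex L3528–L3534 — **an unrefereed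
manuscript under adjudication; nothing here asserts or denies its Theorems 1–2** (ZHANG-L discharge
lane, WP12: the Perron/Mellin glue under the relative node `Typed.Sec12B.U025Rel`, leaf h1212).

The typed object `Typed.Sec12B.lineInt024 c′ χ j d r w` (TypedSection12B) is the printed Perron
integral `(2πi)⁻¹∫_{(1)} (Σ_l χ(l)ξ_j(l;d,r)l^{−(1−β₆+w+s)})((P″₂/dr)^s − (P″₁/dr)^s)ω₁(s)ds/s`
(`ω₁(s) = exp{s²/(4𝓛³⁰)}`, line `s = 1 + it`). The manuscript evaluates it "in a way similar to the
proof of Lemma 8.4" by Landau's contour for the continued quotient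
`Φ(s) = 𝔲(1−s₀+s)L(1−s₀+s+β_{j+1},χ)L(1−s₀+s+β_{j+2},χ)/L(1−s₀+s,χ)`, `s₀ = β₆ − w`, where `𝔲` is the
continuation of Lemma 8.3 (`Skeleton.Lemma83Rel`, clause (ii):
`𝔲(u) = L(u)/(L(u+β_{j+1})L(u+β_{j+2}))·Σ_l χ(l)ξ_j(l;d,r)l^{−u}` for `Re u > 1`). The tree's contour
layer (`Lemma84.ShiftedContour.norm_vline_sub_circ_le(_Z22)`, Section12ShiftedContour(Z22)) is stated
for ONE cut-off point `Y` and the vertical-line integral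
`(1/2π)∫_ℝ Φ(1+it)·Y^{1+it+0}ω₁(1+it+0)/(1+it+0) dt`.

THIS FILE supplies the glue between the two (no estimate, no new definition):

* `xiSeries_shift_eq_Phi` — on `Re(1−s₀+s) > 1` the `ξ`-series at `1−s₀+s` IS `Φ(s)` (Lemma 8.3 (ii),
  `L(u,χ) ≠ 0` for `Re u ≥ 1`, `u ≠ 1`);
* `integrable_vline_integrand` — each single-cut-off integrand `Φ(1+it)·Y^{1+it}ω₁(1+it)/(1+it)` is
  integrable (`Φ(1+it)` is an absolutely convergent `L`-series value, bounded and continuous in `t`;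
  the kernel is Gaussian: `GaussKernelContour.integrable_integrand_line`);
* **`lineInt024_eq_vline_sub`** — for `D ≥ 3`, `d, r ≥ 1`, `Re w > −1` and `s₀ = β₆ − w`:
  `lineInt024 c′ χ j d r w = V(P″₂/dr) − V(P″₁/dr)`, `V(Y)` written LITERALLY as the vertical-line
  term of `ShiftedContour.norm_vline_sub_circ_le_Z22` (so the u025 core applies that theorem twice
  and subtracts);
* the range facts of the u025 range `dr ≤ P″₁/T`: `T ≤ P″₁/dr ≤ P″₂/dr ≤ P″₂ ≤ P`, and the shift facts
  `Re(β₆ − w) = −Re w`, `Im(β₆ − w) ≠ 0` for `|w| = α` (the hypotheses `‖s₀‖ ≤ 5α/2`, `Im s₀ ≠ 0` of the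
  instance layer; `‖β₆ − w‖ ≤ 5α/2` is `Lemma84.center_shift_bounds`).

0 new definitions; standard axioms. «ZHANG-L proves typed steps of arXiv:2211.02515v1 in Lean; the §18
margin is refuted as printed (G-C1); no claim about Landau–Siegel zeros or Theorem 2 follows.»

## References

* Y. Zhang, arXiv:2211.02515v1 (2022), §12 p. 69 (proof of Lemma 12.2, tex L3528–L3534); §8
  Lemma 8.3 p. 46; §4 (4.1) p. 8. [cite: Zhang2022LandauSiegel, §12 p. 69; §8 Lemma 8.3; §4 (4.1)]
* H. L. Montgomery, R. C. Vaughan, *Multiplicative Number Theory I* (CUP 2007), §5.1 (5.15)–(5.16),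
  §6.2. [cite: MontgomeryVaughan2007, §5.1; §6.2]
-/

noncomputable section

open Complex Real MeasureTheory

namespace Literature.NumberTheory.LFunctions.Zhang2022.Typed.Sec12B

open Literature.NumberTheory.LFunctions.Zhang2022.Skeleton
open Literature.NumberTheory.LFunctions.Zhang2022.GaussWeight
open LSeries (term)

variable (c' : ℝ) {D : ℕ} (χ : DirichletCharacter ℂ D)

/-! ### The `ξ`-series on `Re u > 1` is the Lemma-8.3 quotient `Φ` -/

/-- **Lemma 8.3 (ii) solved for the series.** If `𝔲(u) = L(u)/(L(u+β_{j+1})L(u+β_{j+2}))·Σ_lχ(l)ξ_j(l;d,r)l^{−u}`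
for `Re u > 1` (the second clause of `Skeleton.Lemma83Rel`) and
`Φ(s) = 𝔲(1−s₀+s)L(1−s₀+s+β_{j+1})L(1−s₀+s+β_{j+2})/L(1−s₀+s)` (the quotient of the shifted contour
layer), then for `Re(1−s₀+s) > 1`: `Σ_l χ(l)ξ_j(l;d,r)l^{−(1−s₀+s)} = Φ(s)` — the three `L`-values are
non-zero to the right of `Re = 1` (`β_{j+1}, β_{j+2}` purely imaginary).
[cite: Zhang2022LandauSiegel, §8 Lemma 8.3 (ii), §12 proof of Lemma 12.2 p. 69] -/
theorem xiSeries_shift_eq_Phi [NeZero D] {j d r : ℕ} {U Φ : ℂ → ℂ} {s₀ : ℂ}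
    (hU2 : ∀ s : ℂ, 1 < s.re → U s = χ.LFunction s /
        (χ.LFunction (s + betaJ c' D (j + 1)) * χ.LFunction (s + betaJ c' D (j + 2))) *
          xiSeries c' χ j d r s)
    (hΦ : ∀ s, Φ s = U (1 - s₀ + s) * χ.LFunction (1 - s₀ + s + betaJ c' D (j + 1)) *
      χ.LFunction (1 - s₀ + s + betaJ c' D (j + 2)) / χ.LFunction (1 - s₀ + s))
    {s : ℂ} (hs : 1 < (1 - s₀ + s).re) :
    xiSeries c' χ j d r (1 - s₀ + s) = Φ s := by
  set u : ℂ := 1 - s₀ + s with hu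
  have hβ1 : (betaJ c' D (j + 1)).re = 0 := Section8PerronSteps.betaJ_re c' D (j + 1)
  have hβ2 : (betaJ c' D (j + 2)).re = 0 := Section8PerronSteps.betaJ_re c' D (j + 2)
  -- the three `L`-values on `Re ≥ 1`, away from `1`, are non-zero
  have hne : ∀ v : ℂ, 1 < v.re → χ.LFunction v ≠ 0 := by
    intro v hv
    refine DirichletCharacter.LFunction_ne_zero_of_one_le_re χ (Or.inr ?_) hv.le
    intro h
    rw [h, one_re] at hv
    exact lt_irrefl _ hv
  have hL0 : χ.LFunction u ≠ 0 := hne u hs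
  have hLa : χ.LFunction (u + betaJ c' D (j + 1)) ≠ 0 :=
    hne _ (by rw [add_re, hβ1, add_zero]; exact hs)
  have hLb : χ.LFunction (u + betaJ c' D (j + 2)) ≠ 0 :=
    hne _ (by rw [add_re, hβ2, add_zero]; exact hs)
  rw [hΦ s, ← hu, hU2 u hs]
  field_simp

/-! ### Integrability of the single-cut-off integrand on the line `Re s = 1` -/

/-- **The single-cut-off integrand is integrable.** For `D ≥ 3`, `d, r ≥ 1`, `Re s₀ < 1`, `Y > 0`,
with `𝔲`, `Φ` as in `xiSeries_shift_eq_Phi`: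
`t ↦ Φ(1+it)·Y^{1+it}ω₁(1+it)/(1+it)` (`ω₁ = exp{s²/(4𝓛³⁰)}`) is integrable on `ℝ` — on the line,
`Φ(1+it) = Σ_lχ(l)ξ_j(l;d,r)l^{−(2−s₀+it)}` is an absolutely convergent `L`-series value
(`Re = 2 − Re s₀ > 1`), hence continuous in `t` and bounded by `Σ_l|ξ_j(l;d,r)|l^{−(2−Re s₀)}`, and the
kernel is Gaussian (`GaussKernelContour.integrable_integrand_line`). Written with the `+ 0` shift of the
contour layer, literally as there. [cite: Zhang2022LandauSiegel, §12 proof of Lemma 12.2, p. 69]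
[cite: MontgomeryVaughan2007, §5.1 (5.15)–(5.16)] -/
theorem integrable_vline_integrand [NeZero D] (hD : 3 ≤ D) {d r : ℕ} (hd : d ≠ 0) (hr : r ≠ 0) {j : ℕ}
    {U Φ : ℂ → ℂ} {s₀ : ℂ}
    (hU2 : ∀ s : ℂ, 1 < s.re → U s = χ.LFunction s /
        (χ.LFunction (s + betaJ c' D (j + 1)) * χ.LFunction (s + betaJ c' D (j + 2))) *
          xiSeries c' χ j d r s)
    (hΦ : ∀ s, Φ s = U (1 - s₀ + s) * χ.LFunction (1 - s₀ + s + betaJ c' D (j + 1)) *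
      χ.LFunction (1 - s₀ + s + betaJ c' D (j + 2)) / χ.LFunction (1 - s₀ + s))
    (hs₀ : s₀.re < 1) {Y : ℝ} (hY : 0 < Y) :
    Integrable fun t : ℝ => Φ (((1 : ℝ) : ℂ) + t * I) *
      (((Y : ℝ) : ℂ) ^ (((1 : ℝ) : ℂ) + t * I + 0) * omega1 (ell D ^ 30) (((1 : ℝ) : ℂ) + t * I + 0) /
        (((1 : ℝ) : ℂ) + t * I + 0)) := by
  have hΛ : 0 < ell D ^ 30 := ell_pow_thirty_pos hD
  -- the real part on the line
  have hre : ∀ t : ℝ, (1 - s₀ + (((1 : ℝ) : ℂ) + t * I)).re = 2 - s₀.re := by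
    intro t
    simp only [sub_re, add_re, one_re, ofReal_re, mul_re, I_re, mul_zero, ofReal_im, I_im,
      mul_one, sub_self, add_zero]
    ring
  have hσ1 : 1 < 2 - s₀.re := by linarith
  -- on the line, `Φ` is the `L`-series of `a = χ·ξ₀ⱼ(·;d,r)`
  have hline : ∀ t : ℝ, Φ (((1 : ℝ) : ℂ) + t * I) =
      LSeries (fun n => χ (n : ZMod D) * xiZero c' D j n d r) (1 - s₀ + (((1 : ℝ) : ℂ) + t * I)) := by
    intro t
    rw [← xiSeries_eq_LSeries, xiSeries_shift_eq_Phi c' χ hU2 hΦ]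
    rw [hre t]
    exact hσ1
  -- abscissa of absolute convergence `≤ 1`
  have habs : LSeries.abscissaOfAbsConv (fun n => χ (n : ZMod D) * xiZero c' D j n d r) ≤ (1 : ℝ) :=
    LSeries.abscissaOfAbsConv_le_of_forall_lt_LSeriesSummable fun y hy =>
      Lemma83.lseriesSummable_chi_mul_xiZero c' D j χ hd hr (by simpa using hy)
  -- continuity along the line
  have hcont : Continuous fun t : ℝ => Φ (((1 : ℝ) : ℂ) + t * I) := by
    have e : (fun t : ℝ => Φ (((1 : ℝ) : ℂ) + t * I)) =
        (LSeries (fun n => χ (n : ZMod D) * xiZero c' D j n d r)) ∘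
          (fun t : ℝ => 1 - s₀ + (((1 : ℝ) : ℂ) + t * I)) := by
      funext t
      rw [Function.comp_apply, hline t]
    rw [e]
    refine (LSeries_differentiableOn _).continuousOn.comp_continuous (by fun_prop) ?_
    intro t
    show LSeries.abscissaOfAbsConv (fun n => χ (n : ZMod D) * xiZero c' D j n d r) <
      (((1 - s₀ + (((1 : ℝ) : ℂ) + t * I)).re : ℝ) : EReal)
    rw [hre t]
    exact lt_of_le_of_lt habs (by exact_mod_cast hσ1)
  -- a uniform bound along the line
  have hsumσ : LSeriesSummable (fun n => χ (n : ZMod D) * xiZero c' D j n d r)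
      (((2 - s₀.re : ℝ)) : ℂ) :=
    Lemma83.lseriesSummable_chi_mul_xiZero c' D j χ hd hr (by simpa using hσ1)
  have hnorm : Summable fun n => ‖term (fun n => χ (n : ZMod D) * xiZero c' D j n d r)
      (((2 - s₀.re : ℝ)) : ℂ) n‖ := hsumσ.norm
  have hbound : ∀ t : ℝ, ‖Φ (((1 : ℝ) : ℂ) + t * I)‖ ≤
      ∑' n : ℕ, ‖term (fun n => χ (n : ZMod D) * xiZero c' D j n d r) (((2 - s₀.re : ℝ)) : ℂ) n‖ := by
    intro t
    rw [hline t]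
    have hterm : ∀ n : ℕ,
        ‖term (fun n => χ (n : ZMod D) * xiZero c' D j n d r) (1 - s₀ + (((1 : ℝ) : ℂ) + t * I)) n‖ =
          ‖term (fun n => χ (n : ZMod D) * xiZero c' D j n d r) (((2 - s₀.re : ℝ)) : ℂ) n‖ := by
      intro n
      rw [LSeries.norm_term_eq, LSeries.norm_term_eq, hre t, ofReal_re]
    have hnorm' : Summable fun n => ‖term (fun n => χ (n : ZMod D) * xiZero c' D j n d r)
        (1 - s₀ + (((1 : ℝ) : ℂ) + t * I)) n‖ := by
      simpa only [hterm] using hnorm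
    calc ‖LSeries (fun n => χ (n : ZMod D) * xiZero c' D j n d r) (1 - s₀ + (((1 : ℝ) : ℂ) + t * I))‖
        ≤ ∑' n : ℕ, ‖term (fun n => χ (n : ZMod D) * xiZero c' D j n d r)
            (1 - s₀ + (((1 : ℝ) : ℂ) + t * I)) n‖ := norm_tsum_le_tsum_norm hnorm'
      _ = _ := tsum_congr hterm
  exact GaussKernelContour.integrable_integrand_line (β := (0 : ℂ)) (Φ := Φ) hΛ hY (σ := 1)
    (by simp) hcont hbound

/-! ### `lineInt024` is the difference of the two vertical-line integrals -/

/-- Pointwise: the integrand of `lineInt024` is the difference of the two single-cut-off integrands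
(the `ξ`-series value at `2 − β₆ + w + it = 1 − s₀ + (1+it)` is `Φ(1+it)`, `s₀ = β₆ − w`).
[cite: Zhang2022LandauSiegel, §12 proof of Lemma 12.2, p. 69, tex L3528] -/
theorem lineInt024_integrand_eq_vline_sub [NeZero D] (hD : 3 ≤ D) {d r : ℕ} (j : ℕ) {w : ℂ} (hw : -1 < w.re)
    {U Φ : ℂ → ℂ} {s₀ : ℂ}
    (hU2 : ∀ s : ℂ, 1 < s.re → U s = χ.LFunction s /
        (χ.LFunction (s + betaJ c' D (j + 1)) * χ.LFunction (s + betaJ c' D (j + 2))) *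
          xiSeries c' χ j d r s)
    (hΦ : ∀ s, Φ s = U (1 - s₀ + s) * χ.LFunction (1 - s₀ + s + betaJ c' D (j + 1)) *
      χ.LFunction (1 - s₀ + s + betaJ c' D (j + 2)) / χ.LFunction (1 - s₀ + s))
    (hs₀ : s₀ = beta6 D - w) (t : ℝ) :
    xiSeries c' χ j d r (1 - beta6 D + w + (1 + t * I)) *
        (((P2pp D / ((d * r : ℕ) : ℝ) : ℝ) : ℂ) ^ ((1 : ℂ) + t * I) -
          ((P1pp D / ((d * r : ℕ) : ℝ) : ℝ) : ℂ) ^ ((1 : ℂ) + t * I)) *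
        GaussWeight.omega1 (ell D ^ 30) (1 + t * I) / (1 + t * I)
      = Φ (((1 : ℝ) : ℂ) + t * I) *
          (((P2pp D / ((d * r : ℕ) : ℝ) : ℝ) : ℂ) ^ (((1 : ℝ) : ℂ) + t * I + 0) *
            omega1 (ell D ^ 30) (((1 : ℝ) : ℂ) + t * I + 0) / (((1 : ℝ) : ℂ) + t * I + 0)) -
        Φ (((1 : ℝ) : ℂ) + t * I) *
          (((P1pp D / ((d * r : ℕ) : ℝ) : ℝ) : ℂ) ^ (((1 : ℝ) : ℂ) + t * I + 0) *
            omega1 (ell D ^ 30) (((1 : ℝ) : ℂ) + t * I + 0) / (((1 : ℝ) : ℂ) + t * I + 0)) := by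
  have _ := hD
  have e : 1 - beta6 D + w + (1 + t * I) = 1 - s₀ + (((1 : ℝ) : ℂ) + t * I) := by
    rw [hs₀]; push_cast; ring
  have hre : 1 < (1 - s₀ + (((1 : ℝ) : ℂ) + t * I)).re := by
    rw [hs₀]
    have hβ : (beta6 D).re = 0 := by simp [beta6]
    simp only [sub_re, add_re, one_re, ofReal_re, mul_re, I_re, mul_zero, ofReal_im, I_im,
      mul_one, sub_self, add_zero, hβ]
    linarith
  rw [e, xiSeries_shift_eq_Phi c' χ hU2 hΦ hre]
  simp only [add_zero, ofReal_one]
  ring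

/-- **`lineInt024 = V(P″₂/dr) − V(P″₁/dr)`** (§12 p. 69, the Perron integral of u024/u025 as the
difference of two Gaussian-kernel vertical-line integrals of the Lemma-8.3 quotient). For `D ≥ 3`,
`d, r ≥ 1`, `Re w > −1`, `s₀ = β₆ − w`, and `𝔲`, `Φ` as above,
`lineInt024 c′ χ j d r w = (1/2π)∫_ℝ Φ(1+it)(P″₂/dr)^{1+it}ω₁(1+it)/(1+it)dt
                        − (1/2π)∫_ℝ Φ(1+it)(P″₁/dr)^{1+it}ω₁(1+it)/(1+it)dt`,
each term written literally as the vertical-line term of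
`Lemma84.ShiftedContour.norm_vline_sub_circ_le_Z22` (`Y = P″₂/dr`, `P″₁/dr`; `Λ = 𝓛³⁰`).
[cite: Zhang2022LandauSiegel, §12 proof of Lemma 12.2, p. 69, tex L3528–L3534]
[cite: MontgomeryVaughan2007, §5.1 (5.15)–(5.16)] -/
theorem lineInt024_eq_vline_sub [NeZero D] (hD : 3 ≤ D) {d r : ℕ} (hd : d ≠ 0) (hr : r ≠ 0) (j : ℕ)
    {w : ℂ} (hw : -1 < w.re) (U Φ : ℂ → ℂ) {s₀ : ℂ}
    (hU2 : ∀ s : ℂ, 1 < s.re → U s = χ.LFunction s /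
        (χ.LFunction (s + betaJ c' D (j + 1)) * χ.LFunction (s + betaJ c' D (j + 2))) *
          xiSeries c' χ j d r s)
    (hΦ : ∀ s, Φ s = U (1 - s₀ + s) * χ.LFunction (1 - s₀ + s + betaJ c' D (j + 1)) *
      χ.LFunction (1 - s₀ + s + betaJ c' D (j + 2)) / χ.LFunction (1 - s₀ + s))
    (hs₀ : s₀ = beta6 D - w) :
    lineInt024 c' χ j d r w =
      (1 / (2 * π) : ℂ) * (∫ t : ℝ, Φ (((1 : ℝ) : ℂ) + t * I) *
          (((P2pp D / ((d * r : ℕ) : ℝ) : ℝ) : ℂ) ^ (((1 : ℝ) : ℂ) + t * I + 0) *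
            omega1 (ell D ^ 30) (((1 : ℝ) : ℂ) + t * I + 0) / (((1 : ℝ) : ℂ) + t * I + 0))) -
      (1 / (2 * π) : ℂ) * (∫ t : ℝ, Φ (((1 : ℝ) : ℂ) + t * I) *
          (((P1pp D / ((d * r : ℕ) : ℝ) : ℝ) : ℂ) ^ (((1 : ℝ) : ℂ) + t * I + 0) *
            omega1 (ell D ^ 30) (((1 : ℝ) : ℂ) + t * I + 0) / (((1 : ℝ) : ℂ) + t * I + 0))) := by
  have hdr : 0 < ((d * r : ℕ) : ℝ) := by
    exact_mod_cast Nat.pos_of_ne_zero (mul_ne_zero hd hr)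
  have hY₁ : 0 < P1pp D / ((d * r : ℕ) : ℝ) := div_pos (P1pp_pos hD) hdr
  have hY₂ : 0 < P2pp D / ((d * r : ℕ) : ℝ) := by
    have hD0 : (0 : ℝ) < D := by exact_mod_cast lt_of_lt_of_le (by norm_num) hD
    have hℓ : 0 < ell D := Real.log_pos (by exact_mod_cast lt_of_lt_of_le (by norm_num) hD)
    refine div_pos ?_ hdr
    unfold P2pp t0 bigP
    positivity
  have hs₀re : s₀.re < 1 := by
    rw [hs₀]
    have hβ : (beta6 D).re = 0 := by simp [beta6]
    simp only [sub_re, hβ]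
    linarith
  have hint₂ := integrable_vline_integrand c' χ hD hd hr hU2 hΦ hs₀re hY₂
  have hint₁ := integrable_vline_integrand c' χ hD hd hr hU2 hΦ hs₀re hY₁
  unfold lineInt024
  rw [show (((1 / (2 * π) : ℝ)) : ℂ) = (1 / (2 * π) : ℂ) by push_cast; ring]
  rw [integral_congr_ae (ae_of_all _ (fun t =>
    lineInt024_integrand_eq_vline_sub c' χ hD j hw hU2 hΦ hs₀ t)), integral_sub hint₂ hint₁]
  ring

/-! ### The u025 range `dr ≤ P″₁/T`: scale facts for the two cut-off points -/

/-- **`T ≤ P″₁/dr`** when `dr ≤ P″₁/T` (`d, r ≥ 1`). [cite: Zhang2022LandauSiegel, §12 proof of Lemma 12.2, p. 69] -/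
theorem bigT_le_P1pp_div {d r : ℕ} (hd : d ≠ 0) (hr : r ≠ 0)
    (hdr : ((d * r : ℕ) : ℝ) ≤ P1pp D / bigT D) : bigT D ≤ P1pp D / ((d * r : ℕ) : ℝ) := by
  have hdr0 : 0 < ((d * r : ℕ) : ℝ) := by
    exact_mod_cast Nat.pos_of_ne_zero (mul_ne_zero hd hr)
  have hT : 0 < bigT D := by rw [bigT]; exact Real.exp_pos _
  rw [le_div_iff₀ hdr0]
  have := (le_div_iff₀ hT).mp hdr
  linarith [mul_comm (bigT D) (((d * r : ℕ) : ℝ))]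

/-- **`P″₁ ≤ P″₂`**, hence `P″₁/x ≤ P″₂/x` for `x > 0` (`P ≥ 1`, `0.496 ≤ 0.5`).
[cite: Zhang2022LandauSiegel, §12 p. 67] -/
theorem P1pp_div_le_P2pp_div (hD : 3 ≤ D) {x : ℝ} (hx : 0 < x) : P1pp D / x ≤ P2pp D / x := by
  have hD0 : (0 : ℝ) < D := by exact_mod_cast lt_of_lt_of_le (by norm_num) hD
  have hℓ : 0 < ell D := Real.log_pos (by exact_mod_cast lt_of_lt_of_le (by norm_num) hD)
  have ht : 0 ≤ t0 D := by rw [t0]; positivity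
  have hP1 : 1 ≤ bigP D := by rw [bigP]; exact Real.one_le_exp (by positivity)
  have hpow : bigP D ^ (0.496 : ℝ) ≤ bigP D ^ (0.5 : ℝ) :=
    Real.rpow_le_rpow_of_exponent_le hP1 (by norm_num)
  have h : P1pp D ≤ P2pp D := by
    unfold P1pp P2pp
    gcongr
  exact div_le_div_of_nonneg_right h hx.le

/-- **`P″₂/dr ≤ P″₂`** for `d, r ≥ 1`. [cite: Zhang2022LandauSiegel, §12 p. 69] -/
theorem P2pp_div_le_P2pp (hD : 3 ≤ D) {d r : ℕ} (hd : d ≠ 0) (hr : r ≠ 0) :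
    P2pp D / ((d * r : ℕ) : ℝ) ≤ P2pp D := by
  have h1 : (1 : ℝ) ≤ ((d * r : ℕ) : ℝ) := by
    exact_mod_cast Nat.one_le_iff_ne_zero.mpr (mul_ne_zero hd hr)
  have hP2 : 0 ≤ P2pp D := by
    have hD0 : (0 : ℝ) < D := by exact_mod_cast lt_of_lt_of_le (by norm_num) hD
    have hℓ : 0 < ell D := Real.log_pos (by exact_mod_cast lt_of_lt_of_le (by norm_num) hD)
    unfold P2pp t0 bigP
    positivity
  exact div_le_self hP2 h1

/-- **`P″₂ ≤ P`** for `𝓛 ≥ 3` (indeed `P″₂ ≤ PT⁻²`, `Sec12D.P2pp_le_P_div_T_sq`, and `T ≥ 1`).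
[cite: Zhang2022LandauSiegel, §12 p. 68, §7 (7.2)] -/
theorem P2pp_le_bigP (hL : 3 ≤ Real.log D) : P2pp D ≤ bigP D := by
  have h := Sec12D.P2pp_le_P_div_T_sq (D := D) hL
  have hT : 1 ≤ bigT D ^ 2 := one_le_pow₀ (by rw [bigT]; exact Real.one_le_exp (by positivity))
  exact h.trans (div_le_self (bigP_pos D).le hT)

/-- **The two cut-off points of u025 lie in `[T, P]`** (the `Y`-range of the instance layer
`ShiftedContour.norm_vline_sub_circ_le_Z22`): for `𝓛 ≥ 3`, `d, r ≥ 1`, `dr ≤ P″₁/T`,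
`T ≤ P″₁/dr ≤ P` and `T ≤ P″₂/dr ≤ P`. [cite: Zhang2022LandauSiegel, §12 proof of Lemma 12.2, p. 69] -/
theorem u025_cutoffs_mem (hL : 3 ≤ Real.log D) {d r : ℕ} (hd : d ≠ 0) (hr : r ≠ 0)
    (hdr : ((d * r : ℕ) : ℝ) ≤ P1pp D / bigT D) :
    (bigT D ≤ P1pp D / ((d * r : ℕ) : ℝ) ∧ P1pp D / ((d * r : ℕ) : ℝ) ≤ bigP D) ∧
      (bigT D ≤ P2pp D / ((d * r : ℕ) : ℝ) ∧ P2pp D / ((d * r : ℕ) : ℝ) ≤ bigP D) := by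
  have hD : 3 ≤ D := by
    by_contra h
    push Not at h
    have hD2 : (D : ℝ) ≤ 2 := by exact_mod_cast Nat.lt_succ_iff.mp h
    have : Real.log (D : ℝ) ≤ Real.log 2 := by
      rcases Nat.eq_zero_or_pos D with h0 | h0
      · simp [h0]; exact Real.log_nonneg (by norm_num)
      · exact Real.log_le_log (by exact_mod_cast h0) hD2
    have h2 : Real.log 2 < 1 := by
      have := Real.log_two_lt_d9; linarith
    linarith
  have hdr0 : 0 < ((d * r : ℕ) : ℝ) := by
    exact_mod_cast Nat.pos_of_ne_zero (mul_ne_zero hd hr)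
  have h1 := bigT_le_P1pp_div (D := D) hd hr hdr
  have h2 := P1pp_div_le_P2pp_div (D := D) hD hdr0
  have h3 := P2pp_div_le_P2pp (D := D) hD hd hr
  have h4 := P2pp_le_bigP (D := D) hL
  exact ⟨⟨h1, h2.trans (h3.trans h4)⟩, ⟨h1.trans h2, h3.trans h4⟩⟩

/-! ### The shift `s₀ = β₆ − w` on `|w| = α` -/

/-- `Re(β₆ − w) = −Re w` (`β₆ = 3iα/2` is purely imaginary). [cite: Zhang2022LandauSiegel, §2 (2.22)] -/
theorem beta6_sub_re (w : ℂ) : (beta6 D - w).re = -w.re := by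
  simp [beta6]

/-- **`Im(β₆ − w) ≠ 0` on `|w| = α`** (`α > 0`): `Im β₆ = 3α/2 > α ≥ Im w`, so `Im(β₆ − w) ≥ α/2 > 0` —
the hypothesis `Im s₀ ≠ 0` of the instance layer (the pole `ρ̃ − 1 + s₀` is then off the real axis,
in particular `≠ 0`). [cite: Zhang2022LandauSiegel, §12 proof of Lemma 12.2, p. 69] -/
theorem beta6_sub_im_pos (hα : 0 < alpha D) {w : ℂ} (hw : ‖w‖ = alpha D) :
    alpha D / 2 ≤ (beta6 D - w).im ∧ (beta6 D - w).im ≠ 0 := by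
  have him : (beta6 D).im = 3 * alpha D / 2 := by
    simp [beta6]
  have hwim : w.im ≤ alpha D := by
    have := Complex.abs_im_le_norm w
    rw [hw] at this
    exact (le_abs_self _).trans this
  have h : alpha D / 2 ≤ (beta6 D - w).im := by
    rw [sub_im, him]
    linarith
  exact ⟨h, by linarith⟩

end Literature.NumberTheory.LFunctions.Zhang2022.Typed.Sec12B
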